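import Literature.AlgebraicGeometry.Motives.AlgebraicEquivalencePushforwardFibre
import Literature.AlgebraicGeometry.Motives.AlgebraicEquivalenceFibreDimension
import Literature.AlgebraicGeometry.Motives.AlgebraicEquivalenceFiniteOverCodimOne
import Literature.AlgebraicGeometry.Motives.AlgebraicEquivalenceFamilyFiber
import Literature.AlgebraicGeometry.Motives.FunctionFieldOver
import Literature.AlgebraicGeometry.Motives.SubschemeCyclesFundamentalProofs
import Literature.RingTheory.Length.OrdFiniteExtension
import Mathlib.AlgebraicGeometry.Morphisms.SchemeTheoreticallyDominant
import HarnessLib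

/-!
# Proof of Fulton's Prop. 10.1 (a) for the generators of algebraic equivalence, and of
# Prop. 10.3 (a) (proper push-forward preserves algebraic triviality)

This file discharges the named fact
`Literature.AlgebraicGeometry.Motives.map_familyFiberCycle_eq_finrank_smul`
(`Motives/AlgebraicEquivalencePushforwardFacts`; Fulton, *Intersection Theory*, Prop. 10.1 (a) for
the generators, as the identity of cycles `f_* [W_t] = [R(W) : R(W')] • [W'_t]` on `Y`), and with
it the named fact `Literature.AlgebraicGeometry.Motives.map_mem_algTrivial`
(`Motives/AlgebraicEquivalence`; Fulton, Prop. 10.3 (a)) through `map_mem_algTrivial_of_facts`: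

* `map_mem_algTrivial_holds : map_mem_algTrivial d`;
* `map_familyFiberCycle_eq_finrank_smul_holds : map_familyFiberCycle_eq_finrank_smul`.

## Proof

Notation: `f : X → Y` proper over `k`, `T` a smooth integral curve, `t ∈ T(k)`, `W ⊆ X ×ₖ T` a
closed subvariety flat over `T`, `W' = (f × 1_T)(W) ⊆ Y ×ₖ T`, `p : W → W'` (proper, dominant,
`dim W = dim W' = n`), `P = W_t`, `P' = W'_t` the fibre schemes with their closed immersions
`q : P → W`, `q' : P' → W'`, and `p_t : P → P'` (`familyFiberMap`, `p_t ≫ q' = q ≫ p`).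
By the reduction `map_familyFiberCycle_eq_nsmul_of_fibre`
(`Motives/AlgebraicEquivalencePushforwardFibre`) it suffices to prove the identity of cycles
`(p_t)_* [P] = [R(W) : R(W')] • [P']` on `P'` (`map_familyFiberMap_fundamentalCycle`), i.e.
for every point `w'` of `P'` (`map_familyFiberMap_fundamentalCycle_apply`):
`Σ_{w ↦ w'} ℓ(𝒪_{P,w}) · [κ(w) : κ(w')]_{=dim} = [R(W) : R(W')] · ℓ(𝒪_{P',w'})`.

* If `w'` is not a maximal point of `P'`, both sides vanish (multiplicities of non-maximal
  points are `0`; a point of `P` over `w'` of the same dimension is not maximal, since maximal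
  points of `P` and `P'` all have dimension `n - 1`,
  `Motives/AlgebraicEquivalenceFibreDimension`).
* If `w'` is maximal (`finsum_stalkLength_mul_residueDegree_eq_of_isMax`), `v' = q' w'` has
  codimension one in `W'`; `ℓ(𝒪_{P,w}) = ℓ(𝒪_{W,q w} ⧸ a)` and `ℓ(𝒪_{P',w'}) = ℓ(𝒪_{W',v'} ⧸ a)`
  for the image `a` of a uniformiser of `𝒪_{T,t}` (`Motives/AlgebraicEquivalenceFamilyFiber`);
  `p` is finite over an affine neighbourhood `U = Spec R` of `v'`
  (`Motives/AlgebraicEquivalenceFiniteOverCodimOne`), `p⁻¹U = Spec S` with `S` module-finite over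
  `R`; the points of `P` over `w'` are the points of `W` over `v'`, i.e. the primes `Q` of `S`
  over the prime `𝔭` of `v'`, with local rings `S_Q = 𝒪_{W,q w}` and `R_𝔭 = 𝒪_{W',v'}`
  (Mathlib `IsAffineOpen.isLocalization_stalk`), `Frac R = R(W')`, `Frac S = R(W)`; and the
  identity is Fulton's local degree formula
  `Σ_Q [κ(Q) : κ(𝔭)] · ℓ(S_Q ⧸ a S_Q) = [Frac S : Frac R] · ℓ(R_𝔭 ⧸ a R_𝔭)`
  (`Literature/RingTheory/Length/OrdFiniteExtension`: proof of Fulton's Prop. 1.4, Case 2, with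
  Lemmas A.1.2–A.1.3 and A.3).

## References

* W. Fulton, *Intersection Theory*, 2nd ed., Springer (1998), §1.4 (Prop. 1.4), §10.1
  (Prop. 10.1 (a)), §10.3 (Prop. 10.3 (a)), Appendix A.1–A.3.
-/

universe u

open CategoryTheory AlgebraicGeometry Limits MonoidalCategory Order IsLocalRing TopologicalSpace

noncomputable section

namespace Literature.AlgebraicGeometry.Motives

/-! ### Auxiliary: transport of stalk data along an equality of points -/

section Transport

variable {A B C : Scheme.{u}}

/-- `stalkSpecializes` along an equality of points is a local homomorphism (it is the identity
after substituting). [folklore] -/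
theorem isLocalHom_stalkSpecializes_of_eq {x y : A} (h : x = y) :
    IsLocalHom (A.presheaf.stalkSpecializes (specializes_of_eq h)).hom := by
  subst h
  rw [TopCat.Presheaf.stalkSpecializes_refl]
  exact isLocalHom_id _

/-- The residue degree `[κ(x) : κ(f x)]` computed through `𝒪_{Y,y} → 𝒪_{Y,f x} → 𝒪_{X,x}` for
`y = f x`. [folklore] -/
theorem residueDegree_eq_finrank_of_eq (f : A ⟶ B) (x : A) {y : B} (h : f.base x = y)
    [hloc : IsLocalHom ((f.stalkMap x).hom.comp
      (B.presheaf.stalkSpecializes (specializes_of_eq h)).hom)] :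
    f.residueDegree x = @Module.finrank (ResidueField (B.presheaf.stalk y))
      (ResidueField (A.presheaf.stalk x)) _ _
      (ResidueField.map ((f.stalkMap x).hom.comp
        (B.presheaf.stalkSpecializes (specializes_of_eq h)).hom)).toAlgebra.toModule := by
  subst h
  unfold Scheme.Hom.residueDegree
  refine RingTheory.Length.finrank_eq_finrank_of_algebraMap_eq _ _ fun z ↦ ?_
  obtain ⟨z, rfl⟩ := residue_surjective z
  change (f.residueFieldMap x).hom (residue _ z) =
    ResidueField.map ((f.stalkMap x).hom.comp
      (B.presheaf.stalkSpecializes (specializes_of_eq rfl)).hom) (residue _ z)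
  rw [ResidueField.map_residue, RingHom.comp_apply, TopCat.Presheaf.stalkSpecializes_refl]
  rfl

/-- Germs followed by `stalkSpecializes` along an equality, then a stalk map:
`f^♯_x (germ_y r) = germ_x (f^* r)` for `y = f x`. [folklore] -/
theorem stalkMap_stalkSpecializes_germ_of_eq (f : A ⟶ B) (x : A) {y : B} (h : f.base x = y)
    (U : B.Opens) (hy : y ∈ U) (r : Γ(B, U)) :
    (f.stalkMap x).hom ((B.presheaf.stalkSpecializes (specializes_of_eq h)).hom
      ((B.presheaf.germ U y hy).hom r)) =
      (A.presheaf.germ (f ⁻¹ᵁ U) x (show f.base x ∈ U from h ▸ hy)).hom ((f.app U).hom r) := by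
  subst h
  rw [TopCat.Presheaf.germ_stalkSpecializes_apply]
  exact Scheme.Hom.germ_stalkMap_apply f U x hy r

/-- The "fibre ideal" `𝔪_{g x} 𝒪_{A,x}` of `g : A ⟶ C` at `x` only depends on `g` up to equality
of morphisms (both sides are ideals of `𝒪_{A,x}`). [folklore] -/
theorem map_maximalIdeal_stalkMap_congr {g₁ g₂ : A ⟶ C} (h : g₁ = g₂) (x : A) :
    (maximalIdeal (C.presheaf.stalk (g₁.base x))).map (g₁.stalkMap x).hom =
      (maximalIdeal (C.presheaf.stalk (g₂.base x))).map (g₂.stalkMap x).hom := by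
  subst h
  rfl

/-- The fibre ideal of a composite `f ≫ g` at `x` is the extension along
`𝒪_{B,y} → 𝒪_{B,f x} → 𝒪_{A,x}` (`y = f x`) of the fibre ideal of `g` at `y`. [folklore] -/
theorem map_maximalIdeal_stalkMap_comp_of_eq (f : A ⟶ B) (g : B ⟶ C) (x : A) {y : B}
    (h : f.base x = y) :
    (maximalIdeal (C.presheaf.stalk ((f ≫ g).base x))).map ((f ≫ g).stalkMap x).hom =
      ((maximalIdeal (C.presheaf.stalk (g.base y))).map (g.stalkMap y).hom).map
        ((f.stalkMap x).hom.comp (B.presheaf.stalkSpecializes (specializes_of_eq h)).hom) := by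
  subst h
  rw [TopCat.Presheaf.stalkSpecializes_refl, Scheme.Hom.stalkMap_comp, Ideal.map_map]
  rfl

end Transport

/-! ### Auxiliary: affine charts -/

section Charts

variable {A B : Scheme.{u}}

/-- `primeIdealOf` is a left inverse of `fromSpec` on points of the affine open. [folklore] -/
theorem IsAffineOpen.primeIdealOf_fromSpec {U : A.Opens} (hU : IsAffineOpen U)
    (z : Spec Γ(A, U)) (hz : hU.fromSpec.base z ∈ U) :
    hU.primeIdealOf ⟨hU.fromSpec.base z, hz⟩ = z :=
  hU.fromSpec.isOpenEmbedding.injective (hU.fromSpec_primeIdealOf ⟨hU.fromSpec.base z, hz⟩)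

/-- Points of `Spec Γ(A, U)` land in `U` under `fromSpec`. [folklore] -/
theorem IsAffineOpen.fromSpec_base_mem {U : A.Opens} (hU : IsAffineOpen U) (z : Spec Γ(A, U)) :
    hU.fromSpec.base z ∈ U := by
  have h : hU.fromSpec.base z ∈ Set.range hU.fromSpec.base := ⟨z, rfl⟩
  rwa [hU.range_fromSpec] at h

/-- `primeIdealOf` is injective. [folklore] -/
theorem IsAffineOpen.primeIdealOf_injective {U : A.Opens} (hU : IsAffineOpen U) :
    Function.Injective hU.primeIdealOf := fun x y h ↦
  Subtype.ext (by rw [← hU.fromSpec_primeIdealOf x, ← hU.fromSpec_primeIdealOf y, h])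

/-- **Sections over an affine open along a morphism finite over it form a finite module**:
if `f ∣_ U` is finite and `U` affine then `Γ(A, f⁻¹U)` is module-finite over `Γ(B, U)`
(Mathlib `HasAffineProperty IsFinite`). [folklore] -/
theorem finite_app_of_isFinite_morphismRestrict (f : A ⟶ B) {U : B.Opens} (hU : IsAffineOpen U)
    [IsFinite (f ∣_ U)] : (f.app U).hom.Finite := by
  haveI : IsAffine U := hU
  have h := (HasAffineProperty.iff_of_isAffine (P := @IsFinite) (f := f ∣_ U)).mp inferInstance
  have h2 : (f.appLE U (f ⁻¹ᵁ U) le_rfl).hom.Finite := by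
    have e := arrowResLEAppIso f U (f ⁻¹ᵁ U) le_rfl
    rw [Scheme.Hom.resLE_eq_morphismRestrict] at e
    exact (RingHom.finite_respectsIso.arrow_mk_iso_iff e).mp h.2
  rwa [← Scheme.Hom.app_eq_appLE] at h2

/-- The preimage of an affine open along a morphism finite (affine) over it is affine.
[folklore] -/
theorem isAffineOpen_preimage_of_isFinite_morphismRestrict (f : A ⟶ B) {U : B.Opens}
    (hU : IsAffineOpen U) [IsFinite (f ∣_ U)] : IsAffineOpen (f ⁻¹ᵁ U) := by
  haveI : IsAffine U := hU
  exact ((HasAffineProperty.iff_of_isAffine (P := @IsFinite) (f := f ∣_ U)).mp inferInstance).1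

end Charts

/-! ### The length identity at a maximal point of `W'_t` -/

section MaxCase

variable {k : Type u} [Field k] {X Y T : SchemeOver k} (f : X ⟶ Y) [IsProper f.left]
  [LocallyOfFiniteType X.hom] [LocallyOfFiniteType Y.hom]
  [IsIntegral T.left] [SmoothOfRelativeDimension 1 T.hom]
  (W : ClosedSubvariety (X ⊗ T).left) [Flat (W.ι ≫ (CartesianMonoidalCategory.snd X T).left)]
  (t : AlgPoints T k)

set_option maxHeartbeats 400000 in
/-- **The coefficient identity at a maximal point of `W'_t`** (Fulton, *Intersection Theory*,
Prop. 10.1 (a) for the generators, reduced to the fibre schemes; proof of Prop. 1.4, Case 2,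
with App. A.1–A.3).  Notation: `W' = (f × 1_T)(W)`, `p : W → W'`, `P = W_t`, `P' = W'_t`,
`p_t : P → P'`, `q : P → W`, `q' : P' → W'`.  For a maximal point `w'` of `P'` (generic point of
a component), with `v' = q' w'` of codimension one in `W'`:
`Σ_{w ↦ w'} ℓ(𝒪_{P,w}) · [κ(q w) : κ(v')] = [R(W) : R(W')] · ℓ(𝒪_{P',w'})`.
Proof: `ℓ(𝒪_{P,w}) = ℓ(𝒪_{W,q w} ⧸ a)` and `ℓ(𝒪_{P',w'}) = ℓ(𝒪_{W',v'} ⧸ a)` for a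
uniformiser `a` of `𝒪_{T,t}` (`length_stalk_familyFiber_eq`); `p` is finite over an affine
neighbourhood `U = Spec R` of `v'` (`exists_isAffineOpen_isFinite_morphismRestrict`), with
`p⁻¹U = Spec S`, `S` module-finite over `R`; the points of `P` over `w'` are the points of `W`
over `v'`, i.e. the primes of `S` over the prime `𝔭` of `v'`, and their local rings are the
localisations of `S`; now apply the local degree formula
`Literature.RingTheory.Length.finsum_finrank_mul_length_eq_finrank_mul_length`.
[cite: Fulton1998, Proposition 10.1 (a)] -/
theorem finsum_stalkLength_mul_residueDegree_eq_of_isMax (n : ℕ) (hW : W.dim = n)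
    (hW' : (W.image (f ▷ T).left).dim = n)
    (w' : (familyFiber (W.image (f ▷ T).left).toClosedSubscheme t).carrier) (hmax : IsMax w') :
    ∑ᶠ i : ↥((familyFiberMap f W t).base ⁻¹' {w'}),
        (stalkLength (familyFiber W.toClosedSubscheme t).carrier i.1 : ℤ) *
          (AlgebraicCycle.mapCoeff (familyFiberMap f W t) height height i.1 : ℤ) =
      Module.finrank (W.image (f ▷ T).left).carrier.functionField
          (FunctionFieldOver (W.toImage (f ▷ T).left)) *
        (stalkLength (familyFiber (W.image (f ▷ T).left).toClosedSubscheme t).carrier w' : ℤ) := by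
  classical
  revert w' hmax
  -- ### notation
  haveI : Smooth T.hom := SmoothOfRelativeDimension.smooth 1 T.hom
  haveI : IsLocallyNoetherian X.left := LocallyOfFiniteType.isLocallyNoetherian X.hom
  haveI : IsLocallyNoetherian Y.left := LocallyOfFiniteType.isLocallyNoetherian Y.hom
  set F := f ▷ T with hF
  set W' := W.image F.left with hW'def
  set p := W.toImage F.left with hpdef
  set P := (familyFiber W.toClosedSubscheme t).carrier with hP
  set P' := (familyFiber W'.toClosedSubscheme t).carrier with hP'
  set q := pullback.fst W.toClosedSubscheme.ι (sliceAt X t).left with hq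
  set q' := pullback.fst W'.toClosedSubscheme.ι (sliceAt Y t).left with hq'
  set pt := familyFiberMap f W t with hpt
  set g' := W'.ι ≫ (CartesianMonoidalCategory.snd Y T).left with hg'
  set g := W.ι ≫ (CartesianMonoidalCategory.snd X T).left with hg
  set K' := W'.carrier.functionField with hK'
  intro w' hmax
  set v' := q'.base w' with hv'def
  -- instances on `W`, `W'`
  haveI : Flat (W'.toClosedSubscheme.ι ≫ (CartesianMonoidalCategory.snd Y T).left) :=
    ClosedSubvariety.flat_image_ι_snd f W
  haveI : Flat (W.toClosedSubscheme.ι ≫ (CartesianMonoidalCategory.snd X T).left) := ‹_›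
  haveI : IsDominant g' := isDominant_of_flat _
  haveI hft := locallyOfFiniteType_ι_comp_hom W.toClosedSubscheme
  haveI hft' := locallyOfFiniteType_ι_comp_hom W'.toClosedSubscheme
  haveI hNt : IsLocallyNoetherian W.toClosedSubscheme.carrier :=
    LocallyOfFiniteType.isLocallyNoetherian (W.toClosedSubscheme.ι ≫ (X ⊗ T).hom)
  haveI hNt' : IsLocallyNoetherian W'.toClosedSubscheme.carrier :=
    LocallyOfFiniteType.isLocallyNoetherian (W'.toClosedSubscheme.ι ≫ (Y ⊗ T).hom)
  haveI : IsLocallyNoetherian W.carrier := hNt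
  haveI : IsLocallyNoetherian W'.carrier := hNt'
  haveI : LocallyOfFiniteType (W'.ι ≫ (Y ⊗ T).hom) := hft'
  haveI : LocallyOfFiniteType (W.ι ≫ (X ⊗ T).hom) := hft
  haveI : IsClosedImmersion q := by
    haveI := isClosedImmersion_sliceAt_left (X := X) t
    rw [hq]; infer_instance
  haveI : IsClosedImmersion q' := by
    haveI := isClosedImmersion_sliceAt_left (X := Y) t
    rw [hq']; infer_instance
  have hgpg' : g = p ≫ g' := (ClosedSubvariety.toImage_ι_snd f W).symm
  have hptq' : pt ≫ q' = q ≫ p := familyFiberMap_fst f W t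
  have hptq'_apply : ∀ w : P, q'.base (pt.base w) = p.base (q.base w) := fun w ↦ by
    change (pt ≫ q').base w = (q ≫ p).base w
    rw [hptq']
    rfl
  -- ### dimensions
  have hWtop : height (⊤ : W.carrier) = n := by
    rw [← height_base_eq_of_isClosedImmersion' W.ι ⊤]; exact hW
  have hW'top : height (⊤ : W'.carrier) = n := by
    rw [← height_base_eq_of_isClosedImmersion' W'.ι ⊤]; exact hW'
  have hw'ht : height w' + 1 = n := by
    rw [← hW'top]; exact height_familyFiber_add_one_eq_of_isMax W'.toClosedSubscheme t w' hmax
  have hv' : height v' + 1 = n := by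
    rw [hv'def, ← height_familyFiber_eq W'.toClosedSubscheme t w']; exact hw'ht
  have hcoht : coheight v' = 1 := coheight_fst_familyFiber_eq_one_of_isMax W'.toClosedSubscheme t w' hmax
  -- ### the affine chart `U ∋ v'` over which `p` is finite; `R = Γ(W', U)`, `S = Γ(W, p⁻¹U)`
  obtain ⟨U, hU, hv'U, hfinU⟩ := exists_isAffineOpen_isFinite_morphismRestrict p
    (W'.ι ≫ (Y ⊗ T).hom) hWtop hW'top hv'
  haveI := hfinU
  have hVaff : IsAffineOpen (p ⁻¹ᵁ U) := isAffineOpen_preimage_of_isFinite_morphismRestrict p hU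
  haveI : Nonempty U := ⟨⟨v', hv'U⟩⟩
  have hUgen : genericPoint W'.carrier ∈ U :=
    ((genericPoint_spec W'.carrier).mem_open_set_iff U.isOpen).mpr ⟨v', Set.mem_univ _, hv'U⟩
  haveI : Nonempty (p ⁻¹ᵁ U) :=
    ⟨⟨genericPoint W.carrier, RatFn.genericPoint_mem_preimage p hUgen⟩⟩
  letI algRS : Algebra Γ(W'.carrier, U) Γ(W.carrier, p ⁻¹ᵁ U) := (p.app U).hom.toAlgebra
  haveI : Module.Finite Γ(W'.carrier, U) Γ(W.carrier, p ⁻¹ᵁ U) :=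
    finite_app_of_isFinite_morphismRestrict p hU
  have hRS : Function.Injective (algebraMap Γ(W'.carrier, U) Γ(W.carrier, p ⁻¹ᵁ U)) := by
    haveI := IsSchemeTheoreticallyDominant.of_isDominant p
    exact p.app_injective U
  haveI : IsNoetherianRing Γ(W'.carrier, U) :=
    IsLocallyNoetherian.component_noetherian (⟨U, hU⟩ : W'.carrier.affineOpens)
  haveI : IsNoetherianRing Γ(W.carrier, p ⁻¹ᵁ U) :=
    IsLocallyNoetherian.component_noetherian (⟨p ⁻¹ᵁ U, hVaff⟩ : W.carrier.affineOpens)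
  -- the prime `𝔭` of `v'` and the local ring `R_𝔭 = 𝒪_{W',v'}`
  set x' : U := ⟨v', hv'U⟩ with hx'
  set 𝔭 := hU.primeIdealOf x' with h𝔭
  letI algRp : Algebra Γ(W'.carrier, U) (W'.carrier.presheaf.stalk v') :=
    TopCat.Presheaf.algebra_section_stalk W'.carrier.presheaf x'
  haveI : IsLocalization.AtPrime (W'.carrier.presheaf.stalk v') 𝔭.asIdeal :=
    hU.isLocalization_stalk x'
  haveI : Ring.KrullDimLE 1 (W'.carrier.presheaf.stalk v') := by
    have h : coheight (α := W'.carrier) v' = 1 := hcoht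
    rw [Ring.krullDimLE_iff, ringKrullDim_stalk_eq_coheight (X := W'.carrier) v', h]
    rfl
  -- the function fields `K' = R(W') = Frac R`, `K = R(W) = Frac S`
  haveI : IsFractionRing Γ(W'.carrier, U) K' :=
    functionField_isFractionRing_of_isAffineOpen (X := W'.carrier) U hU
  letI algSK : Algebra Γ(W.carrier, p ⁻¹ᵁ U) (FunctionFieldOver p) :=
    show Algebra Γ(W.carrier, p ⁻¹ᵁ U) W.carrier.functionField from inferInstance
  haveI : IsFractionRing Γ(W.carrier, p ⁻¹ᵁ U) (FunctionFieldOver p) :=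
    show IsFractionRing Γ(W.carrier, p ⁻¹ᵁ U) W.carrier.functionField from
      functionField_isFractionRing_of_isAffineOpen (X := W.carrier) _ hVaff
  letI algRK : Algebra Γ(W'.carrier, U) (FunctionFieldOver p) :=
    ((algebraMap K' (FunctionFieldOver p)).comp (algebraMap Γ(W'.carrier, U) K')).toAlgebra
  haveI : IsScalarTower Γ(W'.carrier, U) K' (FunctionFieldOver p) :=
    IsScalarTower.of_algebraMap_eq fun _ ↦ rfl
  haveI : IsScalarTower Γ(W'.carrier, U) Γ(W.carrier, p ⁻¹ᵁ U) (FunctionFieldOver p) := by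
    refine IsScalarTower.of_algebraMap_eq fun r ↦ ?_
    change algebraMap K' (FunctionFieldOver p) (RatFn.ofSection hUgen r) =
      W.carrier.germToFunctionField (p ⁻¹ᵁ U) ((p.app U).hom r)
    rw [FunctionFieldOver.algebraMap_apply, RatFn.functionFieldMap_ofSection p hUgen r]
    rfl
  -- ### the points of `P` over `w'`: index set `ι`, primes `Q i` of `S`, local rings `𝒪_{W, q i}`
  have hqp : ∀ i : ↥(pt.base ⁻¹' {w'}), p.base (q.base i.1) = v' := fun i ↦ by
    rw [← hptq'_apply, show pt.base i.1 = w' from i.2]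
  have hmemV : ∀ i : ↥(pt.base ⁻¹' {w'}), q.base i.1 ∈ p ⁻¹ᵁ U := fun i ↦ by
    change p.base (q.base i.1) ∈ U
    rw [hqp i]; exact hv'U
  set xV : ↥(pt.base ⁻¹' {w'}) → ↥(p ⁻¹ᵁ U) := fun i ↦ ⟨q.base i.1, hmemV i⟩ with hxV
  set Q : ↥(pt.base ⁻¹' {w'}) → Ideal Γ(W.carrier, p ⁻¹ᵁ U) := fun i ↦
    (hVaff.primeIdealOf (xV i)).asIdeal with hQ
  haveI : ∀ i, (Q i).IsPrime := fun i ↦ (hVaff.primeIdealOf (xV i)).isPrime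
  letI algSL : ∀ i : ↥(pt.base ⁻¹' {w'}),
      Algebra Γ(W.carrier, p ⁻¹ᵁ U) (W.carrier.presheaf.stalk (q.base i.1)) := fun i ↦
    TopCat.Presheaf.algebra_section_stalk W.carrier.presheaf (xV i)
  haveI : ∀ i : ↥(pt.base ⁻¹' {w'}),
      IsLocalization.AtPrime (W.carrier.presheaf.stalk (q.base i.1)) (Q i) := fun i ↦
    hVaff.isLocalization_stalk (xV i)
  -- the local homomorphisms `ψ i : 𝒪_{W',v'} → 𝒪_{W', p (q i)} → 𝒪_{W, q i}`
  set ψ : ∀ i : ↥(pt.base ⁻¹' {w'}),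
      (W'.carrier.presheaf.stalk v' : Type u) →+* (W.carrier.presheaf.stalk (q.base i.1) : Type u) :=
    fun i ↦ (p.stalkMap (q.base i.1)).hom.comp
      (W'.carrier.presheaf.stalkSpecializes (specializes_of_eq (hqp i))).hom with hψdef
  haveI : ∀ i, IsLocalHom (ψ i) := fun i ↦ by
    haveI := isLocalHom_stalkSpecializes_of_eq (hqp i)
    exact RingHom.isLocalHom_comp _ _
  have hψ : ∀ i r, ψ i (algebraMap Γ(W'.carrier, U) (W'.carrier.presheaf.stalk v') r) =
      algebraMap Γ(W.carrier, p ⁻¹ᵁ U) (W.carrier.presheaf.stalk (q.base i.1))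
        (algebraMap Γ(W'.carrier, U) Γ(W.carrier, p ⁻¹ᵁ U) r) := fun i r ↦
    stalkMap_stalkSpecializes_germ_of_eq p (q.base i.1) (hqp i) U hv'U r
  -- residue degrees
  set d : ↥(pt.base ⁻¹' {w'}) → ℕ := fun i ↦ p.residueDegree (q.base i.1) with hd_def
  have hd : ∀ i, d i = @Module.finrank (ResidueField (W'.carrier.presheaf.stalk v'))
      (ResidueField (W.carrier.presheaf.stalk (q.base i.1))) _ _
      (ResidueField.map (ψ i)).toAlgebra.toModule := fun i ↦
    residueDegree_eq_finrank_of_eq p (q.base i.1) (hqp i)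
  -- ### the uniformiser `π` of `𝒪_{T,t}` and its image `a ∈ 𝒪_{W',v'}`
  obtain ⟨π, hπ⟩ := exists_maximalIdeal_stalk_eq_span T (g'.base v')
  have hyv : g'.base v' = t.toSpecHom.base (closedPoint k) :=
    snd_fst_familyFiber_apply W'.toClosedSubscheme t w'
  have hπ0 : π ≠ 0 := by
    rintro rfl
    have hne : maximalIdeal (T.left.presheaf.stalk (g'.base v')) ≠ ⊥ := by
      rw [hyv]; exact AlgPoints.maximalIdeal_stalk_ne_bot T t
    exact hne (by rw [hπ, Ideal.span_singleton_eq_bot])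
  set a := (g'.stalkMap v').hom π with ha_def
  have ha0 : a ≠ 0 := fun h ↦ hπ0 (stalkMap_injective_of_isDominant g' v'
    (show (g'.stalkMap v').hom π = (g'.stalkMap v').hom 0 by rw [map_zero]; exact h))
  have h𝔞 : (maximalIdeal (T.left.presheaf.stalk (g'.base v'))).map (g'.stalkMap v').hom =
      Ideal.span {a} := by
    rw [hπ, Ideal.map_span, Set.image_singleton]
  -- ### `Q` is a bijection onto the primes of `S` over `𝔭`
  have happ : p.appLE U (p ⁻¹ᵁ U) le_rfl = p.app U := (Scheme.Hom.app_eq_appLE p).symm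
  have hQp : ∀ i, (Q i).under Γ(W'.carrier, U) = 𝔭.asIdeal := fun i ↦ by
    have h := IsAffineOpen.comap_primeIdealOf_appLE U hU (p ⁻¹ᵁ U) hVaff le_rfl (hmemV i)
    rw [happ] at h
    have e2 : hU.primeIdealOf ⟨p.base (q.base i.1), (le_rfl : p ⁻¹ᵁ U ≤ p ⁻¹ᵁ U) (hmemV i)⟩ =
        𝔭 := congrArg hU.primeIdealOf (Subtype.ext (hqp i))
    change (PrimeSpectrum.comap (p.app U).hom (hVaff.primeIdealOf (xV i))).asIdeal = 𝔭.asIdeal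
    rw [h, e2]
  have hq_inj : Function.Injective q.base := q.isClosedEmbedding.injective
  have hQinj : Function.Injective Q := fun i j hij ↦ by
    have h1 : hVaff.primeIdealOf (xV i) = hVaff.primeIdealOf (xV j) := PrimeSpectrum.ext hij
    have h2 := congrArg Subtype.val (IsAffineOpen.primeIdealOf_injective hVaff h1)
    exact Subtype.ext (hq_inj h2)
  have hQsurj : ∀ P₀ : Ideal Γ(W.carrier, p ⁻¹ᵁ U), P₀.IsPrime →
      P₀.under Γ(W'.carrier, U) = 𝔭.asIdeal → ∃ i, Q i = P₀ := by
    intro P₀ hP₀ hP₀p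
    let z : PrimeSpectrum Γ(W.carrier, p ⁻¹ᵁ U) := ⟨P₀, hP₀⟩
    have hwvV : hVaff.fromSpec.base z ∈ p ⁻¹ᵁ U := IsAffineOpen.fromSpec_base_mem hVaff z
    have hz : hVaff.primeIdealOf ⟨hVaff.fromSpec.base z, hwvV⟩ = z :=
      IsAffineOpen.primeIdealOf_fromSpec hVaff z hwvV
    -- `p (fromSpec z) = v'`
    have hpw : p.base (hVaff.fromSpec.base z) = v' := by
      have h := IsAffineOpen.comap_primeIdealOf_appLE U hU (p ⁻¹ᵁ U) hVaff le_rfl hwvV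
      rw [happ, hz] at h
      have h3 : hU.primeIdealOf ⟨p.base (hVaff.fromSpec.base z),
          (le_rfl : p ⁻¹ᵁ U ≤ p ⁻¹ᵁ U) hwvV⟩ = hU.primeIdealOf x' := by
        rw [← h]; exact PrimeSpectrum.ext hP₀p
      exact congrArg Subtype.val (IsAffineOpen.primeIdealOf_injective hU h3)
    -- lift the point to `P`
    have hgw : g.base (hVaff.fromSpec.base z) = t.toSpecHom.base (closedPoint k) := by
      rw [hgpg']
      change g'.base (p.base (hVaff.fromSpec.base z)) = _
      rw [hpw]
      exact hyv
    obtain ⟨w, hw⟩ := exists_fst_familyFiber_eq W.toClosedSubscheme t _ hgw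
    have hptw : pt.base w = w' := by
      apply q'.isClosedEmbedding.injective
      rw [hptq'_apply]
      change p.base (q.base w) = v'
      rw [show q.base w = hVaff.fromSpec.base z from hw, hpw]
    refine ⟨⟨w, hptw⟩, ?_⟩
    have hx : xV ⟨w, hptw⟩ = ⟨hVaff.fromSpec.base z, hwvV⟩ := Subtype.ext hw
    change (hVaff.primeIdealOf (xV ⟨w, hptw⟩)).asIdeal = P₀
    rw [hx, hz]
  -- ### the local degree formula
  have key := RingTheory.Length.finsum_finrank_mul_length_eq_finrank_mul_length hRS 𝔭.asIdeal
    (W'.carrier.presheaf.stalk v') K' (FunctionFieldOver p) Q hQp hQinj hQsurj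
    (fun i ↦ (W.carrier.presheaf.stalk (q.base i.1) : Type u)) ψ hψ d hd a ha0
  -- ### the lengths are the multiplicities of the fibre cycles (`length_stalk_familyFiber_eq`)
  have hR : Module.length (P'.presheaf.stalk w') (P'.presheaf.stalk w') =
      Module.length (W'.carrier.presheaf.stalk v') ((W'.carrier.presheaf.stalk v') ⧸
        (maximalIdeal (T.left.presheaf.stalk (g'.base v'))).map (g'.stalkMap v').hom) :=
    length_stalk_familyFiber_eq W'.toClosedSubscheme t w'
  rw [h𝔞] at hR
  have hL : ∀ i : ↥(pt.base ⁻¹' {w'}),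
      Module.length (P.presheaf.stalk i.1) (P.presheaf.stalk i.1) =
        Module.length (W.carrier.presheaf.stalk (q.base i.1))
          (W.carrier.presheaf.stalk (q.base i.1) ⧸ Ideal.span {ψ i a}) := fun i ↦ by
    have h : Module.length (P.presheaf.stalk i.1) (P.presheaf.stalk i.1) =
        Module.length (W.carrier.presheaf.stalk (q.base i.1))
          (W.carrier.presheaf.stalk (q.base i.1) ⧸
            (maximalIdeal (T.left.presheaf.stalk (g.base (q.base i.1)))).map
              (g.stalkMap (q.base i.1)).hom) :=
      length_stalk_familyFiber_eq W.toClosedSubscheme t i.1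
    have hJ : (maximalIdeal (T.left.presheaf.stalk (g.base (q.base i.1)))).map
        (g.stalkMap (q.base i.1)).hom = Ideal.span {ψ i a} := by
      rw [map_maximalIdeal_stalkMap_congr hgpg' (q.base i.1),
        map_maximalIdeal_stalkMap_comp_of_eq p g' (q.base i.1) (hqp i), h𝔞, Ideal.map_span,
        Set.image_singleton]
    rw [hJ] at h
    exact h
  -- ### all points of `P` over `w'` are maximal, so all the lengths are finite
  have hfinW : height (⊤ : W.toClosedSubscheme.carrier) < ⊤ := by
    rw [show height (⊤ : W.toClosedSubscheme.carrier) = n from hWtop]; exact ENat.coe_lt_top n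
  have hmaxP : ∀ i : ↥(pt.base ⁻¹' {w'}), IsMax i.1 := fun i ↦ by
    refine isMax_familyFiber_of_height_add_one_eq W.toClosedSubscheme t hfinW i.1 ?_
    rw [height_familyFiber_eq W.toClosedSubscheme t i.1]
    have h1 : height (α := W.carrier) (q.base i.1) = height v' :=
      height_eq_of_apply_eq p hWtop hW'top hv' (hqp i)
    have h2 : height (α := W.carrier) (q.base i.1) + 1 = n := by rw [h1]; exact hv'
    exact h2.trans hWtop.symm
  have hfinL : ∀ i : ↥(pt.base ⁻¹' {w'}),
      Module.length (P.presheaf.stalk i.1) (P.presheaf.stalk i.1) < ⊤ := fun i ↦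
    isGenericComponentPoint_of_isMax (hmaxP i)
  -- ### the push-forward coefficients are the residue degrees `d i = [κ(q i) : κ(v')]`
  have hheight : ∀ i : ↥(pt.base ⁻¹' {w'}), height i.1 = height (pt.base i.1) := fun i ↦ by
    rw [height_familyFiber_eq W.toClosedSubscheme t i.1, show pt.base i.1 = w' from i.2,
      height_familyFiber_eq W'.toClosedSubscheme t w']
    exact height_eq_of_apply_eq p hWtop hW'top hv' (hqp i)
  have hcoeff : ∀ i : ↥(pt.base ⁻¹' {w'}), AlgebraicCycle.mapCoeff pt height height i.1 = d i :=
    fun i ↦ by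
    unfold AlgebraicCycle.mapCoeff
    rw [if_pos (hheight i)]
    have h1 : (pt ≫ q').residueDegree i.1 = pt.residueDegree i.1 := by
      rw [residueDegree_comp]
      exact (congrArg (pt.residueDegree i.1 * ·)
        (residueDegree_eq_one_of_surjectiveOnStalks q' (pt.base i.1))).trans (mul_one _)
    have h2 : (q ≫ p).residueDegree i.1 = p.residueDegree (q.base i.1) := by
      rw [residueDegree_comp]
      exact (congrArg (· * p.residueDegree (q.base i.1))
        (residueDegree_eq_one_of_surjectiveOnStalks q i.1)).trans (one_mul _)
    change pt.residueDegree i.1 = p.residueDegree (q.base i.1)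
    rw [← h1, hptq']
    exact h2
  have hfinR : Module.length (P'.presheaf.stalk w') (P'.presheaf.stalk w') < ⊤ :=
    isGenericComponentPoint_of_isMax hmax
  haveI : Finite ↥(pt.base ⁻¹' {w'}) := by
    haveI := (finite_preimage_singleton_of_height p (W'.ι ≫ (Y ⊗ T).hom) hWtop hW'top hv').to_subtype
    refine Finite.of_injective
      (fun i : ↥(pt.base ⁻¹' {w'}) ↦ (⟨q.base i.1, hqp i⟩ : ↥(p.base ⁻¹' {v'}))) ?_
    intro i j h
    exact Subtype.ext (hq_inj (congrArg Subtype.val h))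
  -- ### assembly in `ℕ`, then in `ℤ`
  have key2 : ∑ᶠ i : ↥(pt.base ⁻¹' {w'}), ((d i * stalkLength P i.1 : ℕ) : ℕ∞) =
      ((Module.finrank K' (FunctionFieldOver p) * stalkLength P' w' : ℕ) : ℕ∞) := by
    have hl : ∀ i : ↥(pt.base ⁻¹' {w'}), ((stalkLength P i.1 : ℕ) : ℕ∞) =
        Module.length (W.carrier.presheaf.stalk (q.base i.1))
          (W.carrier.presheaf.stalk (q.base i.1) ⧸ Ideal.span {ψ i a}) := fun i ↦ by
      rw [← hL i]; exact ENat.coe_toNat (hfinL i).ne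
    have hr : ((stalkLength P' w' : ℕ) : ℕ∞) = Module.length (W'.carrier.presheaf.stalk v')
        (W'.carrier.presheaf.stalk v' ⧸ Ideal.span {a}) := by
      rw [← hR]; exact ENat.coe_toNat hfinR.ne
    simp only [Nat.cast_mul, hl, hr]
    exact key
  have key3 : ((∑ᶠ i : ↥(pt.base ⁻¹' {w'}), d i * stalkLength P i.1 : ℕ) : ℕ∞) =
      ((Module.finrank K' (FunctionFieldOver p) * stalkLength P' w' : ℕ) : ℕ∞) := by
    rw [← key2]
    exact (Nat.castAddMonoidHom ℕ∞).map_finsum (Set.toFinite _)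
  have key4 := Nat.cast_injective (R := ℕ∞) key3
  calc ∑ᶠ i : ↥(pt.base ⁻¹' {w'}),
        (stalkLength P i.1 : ℤ) * (AlgebraicCycle.mapCoeff pt height height i.1 : ℤ)
      = ∑ᶠ i : ↥(pt.base ⁻¹' {w'}), ((d i * stalkLength P i.1 : ℕ) : ℤ) :=
        finsum_congr fun i ↦ by rw [hcoeff i, Nat.cast_mul, mul_comm]
    _ = ((∑ᶠ i : ↥(pt.base ⁻¹' {w'}), d i * stalkLength P i.1 : ℕ) : ℤ) :=
        ((Nat.castAddMonoidHom ℤ).map_finsum (Set.toFinite _)).symm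
    _ = ((Module.finrank K' (FunctionFieldOver p) * stalkLength P' w' : ℕ) : ℤ) := by rw [key4]
    _ = _ := by rw [Nat.cast_mul]

end MaxCase

/-! ### The identity of fibre cycles `(p_t)_* [W_t] = [R(W) : R(W')] • [W'_t]` and the named fact -/

section Pointwise

variable {k : Type u} [Field k] {X Y T : SchemeOver k} (f : X ⟶ Y) [IsProper f.left]
  [LocallyOfFiniteType X.hom] [LocallyOfFiniteType Y.hom] [IsLocallyNoetherian X.left]
  [IsLocallyNoetherian Y.left] [IsIntegral T.left] [SmoothOfRelativeDimension 1 T.hom]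
  (W : ClosedSubvariety (X ⊗ T).left) [Flat (W.ι ≫ (CartesianMonoidalCategory.snd X T).left)]
  (t : AlgPoints T k) (hZ : locallyFinsupp_fundamentalCycleFun.{u})

/-- **The coefficients of `(p_t)_* [W_t]` and of `[R(W) : R(W')] • [W'_t]` agree at every point
of `W'_t`** (`dim W = dim W'`).  At a maximal point this is
`finsum_stalkLength_mul_residueDegree_eq_of_isMax`; at a non-maximal point `w'` both sides
vanish: `ℓ(𝒪_{W'_t,w'}) = 0` by convention (`𝒪` not Artinian, `isGenericComponentPoint_iff_isMax`),
and a point `w ↦ w'` of `W_t` of the same dimension is not maximal either (maximal points of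
`W_t`, `W'_t` all have dimension `dim W - 1`, `height_familyFiber_add_one_eq_of_isMax`), so its
multiplicity is `0`, while points of other dimensions have push-forward coefficient `0`.
[cite: Fulton1998, Proposition 10.1 (a)] -/
theorem map_familyFiberMap_fundamentalCycle_apply (n : ℕ) (hW : W.dim = n)
    (hW' : (W.image (f ▷ T).left).dim = n)
    (w' : (familyFiber (W.image (f ▷ T).left).toClosedSubscheme t).carrier) :
    AlgebraicCycle.map (familyFiberMap f W t) height height
        (fundamentalCycle (familyFiber W.toClosedSubscheme t).carrier hZ) w' =
      (Module.finrank (W.image (f ▷ T).left).carrier.functionField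
          (FunctionFieldOver (W.toImage (f ▷ T).left)) : ℤ) *
        fundamentalCycle (familyFiber (W.image (f ▷ T).left).toClosedSubscheme t).carrier hZ w' := by
  rw [AlgebraicCycle.map, Function.locallyFinsupp.map_apply]
  simp only [fundamentalCycle_apply, fundamentalCycleFun_apply]
  by_cases hmax : IsMax w'
  · rw [← finsum_set_coe_eq_finsum_mem]
    exact finsum_stalkLength_mul_residueDegree_eq_of_isMax f W t n hW hW' w' hmax
  · -- both sides vanish
    haveI : Smooth T.hom := SmoothOfRelativeDimension.smooth 1 T.hom
    haveI : Flat ((W.image (f ▷ T).left).toClosedSubscheme.ι ≫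
        (CartesianMonoidalCategory.snd Y T).left) := ClosedSubvariety.flat_image_ι_snd f W
    haveI : Flat (W.toClosedSubscheme.ι ≫ (CartesianMonoidalCategory.snd X T).left) := ‹_›
    have h0' : stalkLength (familyFiber (W.image (f ▷ T).left).toClosedSubscheme t).carrier w' = 0 :=
      stalkLength_eq_zero_of_not_isGenericComponentPoint fun h ↦
        hmax ((isGenericComponentPoint_iff_isMax_holds _ w').mp h)
    rw [h0', Nat.cast_zero, mul_zero]
    refine finsum_mem_of_eqOn_zero fun w hw ↦ ?_
    have hw' : (familyFiberMap f W t).base w = w' := hw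
    change (stalkLength (familyFiber W.toClosedSubscheme t).carrier w : ℤ) *
      (AlgebraicCycle.mapCoeff (familyFiberMap f W t) height height w : ℤ) = 0
    unfold AlgebraicCycle.mapCoeff
    split_ifs with hh
    · -- same dimension: `w` is not a maximal point of `W_t` either
      have hWtop : height (⊤ : W.carrier) = n := by
        rw [← height_base_eq_of_isClosedImmersion' W.ι ⊤]; exact hW
      have hW'top : height (⊤ : (W.image (f ▷ T).left).carrier) = n := by
        rw [← height_base_eq_of_isClosedImmersion' (W.image (f ▷ T).left).ι ⊤]; exact hW'
      have hfin' : height (⊤ : (W.image (f ▷ T).left).toClosedSubscheme.carrier) < ⊤ := by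
        rw [show height (⊤ : (W.image (f ▷ T).left).toClosedSubscheme.carrier) = n from hW'top]
        exact ENat.coe_lt_top n
      have hx0 : stalkLength (familyFiber W.toClosedSubscheme t).carrier w = 0 := by
        refine stalkLength_eq_zero_of_not_isGenericComponentPoint fun hgen ↦ hmax ?_
        have hwmax : IsMax w := (isGenericComponentPoint_iff_isMax_holds _ w).mp hgen
        have h1 := height_familyFiber_add_one_eq_of_isMax W.toClosedSubscheme t w hwmax
        refine isMax_familyFiber_of_height_add_one_eq (W.image (f ▷ T).left).toClosedSubscheme t
          hfin' w' ?_
        rw [← hw', ← hh]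
        exact h1.trans (hWtop.trans hW'top.symm)
      rw [hx0, Nat.cast_zero, zero_mul]
    · rw [Nat.cast_zero, mul_zero]

/-- **Fulton's Prop. 10.1 (a) for the generators, on the fibre schemes**: the proper morphism
of fibres `p_t : W_t ⟶ W'_t` pushes the fundamental cycle of `W_t` to `[R(W) : R(W')]` times the
fundamental cycle of `W'_t` (`dim W' = dim W`). [cite: Fulton1998, Proposition 10.1 (a)] -/
theorem map_familyFiberMap_fundamentalCycle (n : ℕ) (hW : W.dim = n)
    (hW' : (W.image (f ▷ T).left).dim = n) :
    AlgebraicCycle.map (familyFiberMap f W t) height height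
        (fundamentalCycle (familyFiber W.toClosedSubscheme t).carrier hZ) =
      Module.finrank (W.image (f ▷ T).left).carrier.functionField
          (FunctionFieldOver (W.toImage (f ▷ T).left)) •
        fundamentalCycle (familyFiber (W.image (f ▷ T).left).toClosedSubscheme t).carrier hZ := by
  ext w'
  rw [map_familyFiberMap_fundamentalCycle_apply f W t hZ n hW hW' w',
    Function.locallyFinsuppWithin.coe_nsmul, Pi.smul_apply, nsmul_eq_mul]

end Pointwise

/-- **Proof of the named fact `map_familyFiberCycle_eq_finrank_smul`** (Fulton,
*Intersection Theory*, Prop. 10.1 (a) for the generators of algebraic equivalence, as an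
identity of cycles on `Y`): from the identity on the fibre schemes
(`map_familyFiberMap_fundamentalCycle`) by the reduction
`map_familyFiberCycle_eq_nsmul_of_fibre`. [cite: Fulton1998, Proposition 10.1 (a)] -/
theorem map_familyFiberCycle_eq_finrank_smul_holds : map_familyFiberCycle_eq_finrank_smul.{u} := by
  intro k _ X Y T f _ _ _ _ _ _ _ W _ t hZ n hW hW'
  exact map_familyFiberCycle_eq_nsmul_of_fibre f W t hZ _
    (map_familyFiberMap_fundamentalCycle f W t hZ n hW hW')

/-- **Fulton, Intersection Theory, Prop. 10.3 (a): proper push-forward preserves algebraic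
triviality** — the named fact `map_mem_algTrivial` of `Motives/AlgebraicEquivalence`, discharged:
`map_mem_algTrivial_of_facts` (`Motives/AlgebraicEquivalencePushforwardFacts`) fed with
`map_familyFiberCycle_eq_finrank_smul_holds`. [cite: Fulton1998, Proposition 10.3 (a)] -/
theorem map_mem_algTrivial_holds {k : Type u} [Field k] {X Y : SchemeOver k} (d : ℕ) :
    map_mem_algTrivial (X := X) (Y := Y) d :=
  map_mem_algTrivial_of_facts map_familyFiberCycle_eq_finrank_smul_holds d

end Literature.AlgebraicGeometry.Motives

end
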